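import Summits.SmoothPoincare4.SmoothPoincare4.Theorems.EntropyRungNoncompactShrinkerGapStubCompactSupportLSI
import Literature.Geometry.Riemannian.ShrinkerPotentialGrowthProofs

/-!
# Stub `stub_compactSupportLSI_of_nonneg` of line `collapsed-ends-usc` (crux
# `EntropyRung.NoncompactShrinkerGap`, stmt-SmoothPoincare4-10868): Carrillo–Ni's logarithmic
# Sobolev inequality for compactly supported test functions, with the growth fact weakened to (2.6)

This is the landed stub `NoncompactShrinkerGapCompactSupportLSI.stub_compactSupportLSI` (U1,
file `EntropyRungNoncompactShrinkerGapStubCompactSupportLSI.lean`) with its first antecedent, the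
named fact `shrinkerPotentialGrowth` (Haslhofer–Müller 2011, §2: (2.6), Lemma 2.1, Lemma 2.2),
WEAKENED to (2.6) alone: "on every complete connected normalised gradient shrinker of every
dimension, `R ≥ 0`". On a complete connected normalised gradient shrinker `(M, g, f)`
(`Ric + Hess f = g/2`, `R + |∇f|² = f`, closed `g`-balls compact) and for every smooth compactly
supported `w` with `Z = ∫ w² dV > 0`,
`log((4π)^{-n/2} ∫ e^{-f} dV) ≤ (∫ (R w² + 4|∇w|² − w² log w²) dV)/Z + log Z + log (4π)^{-n/2} − n`
(Haslhofer–Müller 2011, (2.15)–(2.16); at `n = 4` the registered signature).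

PROOF. The landed proof `NoncompactShrinkerGapCompactSupportLSI.log_le_functional` uses the
growth fact only through (a) `R ≥ 0`, (b) a minimum point `p` of `f`, (c) the lower quadratic
growth `¼ (r − 5n)₊² ≤ f(x)` for `r ≤ d(p, x)`. Given (2.6), (a) is the hypothesis at the shrinker
at hand, and (b), (c) are Haslhofer–Müller's Lemma 2.1, PROVED given (2.6) in
`Literature/Geometry/Riemannian/ShrinkerPotentialGrowthProofs.lean`
(`HaslhoferMuller.exists_forall_potential_le`, `HaslhoferMuller.potential_lower_of_scalarCurvature_nonneg`;
the regularity instances of the smooth Levi-Civita connection come from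
`isLocallyContMDiff_leviCivita_holds`, exactly as in
`HaslhoferMuller.shrinkerPotentialGrowth_of_nonneg_of_volume`). The rest is the landed argument
verbatim: properness of `f`, the weighted integrability of `f, R, |∇f|²`
(`ShrinkerEntropyProofs`), `d(p, ·)² ≤ 8f + 50n²`, Carrillo–Ni (i)–(iii), the mixture step
`NoncompactShrinkerGapCompactSupportLSI.mixture_step` for every `0 < δ < 1`, and `δ → 0`.
Everything here is proved; no definition and no named fact is introduced. The hypothesis `R ≤ C`
of the registered signature is not needed.
-/

noncomputable section

-- `Summit.SmoothPoincare4.SmoothPoincare4.…` (summit = problem) trips `dupNamespace` on every decl.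
set_option linter.dupNamespace false

open scoped Manifold ContDiff ENNReal NNReal Topology
open MeasureTheory Set Filter
open Literature.Geometry.Lorentzian Literature.Geometry.Riemannian

namespace Summit.SmoothPoincare4.SmoothPoincare4.Theorems.NoncompactShrinkerGapCompactSupportLSIOfNonneg

open Summit.SmoothPoincare4.SmoothPoincare4.Theorems.NoncompactShrinkerGapCompactSupportLSI

/-! ## The inequality on a complete shrinker with `R ≥ 0` (any dimension) -/

section Shrinker

variable {n : ℕ} {M : Type} [TopologicalSpace M] [T2Space M] [SecondCountableTopology M]
  [ChartedSpace (EuclideanSpace ℝ (Fin n)) M] [IsManifold (𝓡 n) ∞ M] [ConnectedSpace M]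
  [T3Space M] [MeasurableSpace M] [BorelSpace M]

/-- **Carrillo–Ni's LSI for compactly supported test functions, given (2.6)** (Haslhofer–Müller
2011, (2.15)–(2.16)), any dimension `n`: if `R ≥ 0` on every complete connected normalised
gradient shrinker ((2.6)) and Carrillo–Ni's theorem holds, then on a complete connected gradient
shrinker normalised by `R + |∇f|² = f`, for `w` smooth with compact support and `Z = ∫ w² > 0`,
`log((4π)^{-n/2}∫e^{-f}) ≤ (∫ (R w² + 4|∇w|² − w² log w²))/Z + log Z + log (4π)^{-n/2} − n`.
Proof: `R ≥ 0` from (2.6); a minimum point `p` of `f` and the lower growth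
`¼(r − 5n)₊² ≤ f` (`HaslhoferMuller.exists_forall_potential_le`,
`HaslhoferMuller.potential_lower_of_scalarCurvature_nonneg`); then verbatim as
`NoncompactShrinkerGapCompactSupportLSI.log_le_functional`: `f` is proper, whence the weighted
integrability (`ShrinkerEntropyProofs`) and `d(p,·)² ≤ 8f + 50n²`; Carrillo–Ni (i)–(iii); the
mixture step `mixture_step` for every `0 < δ < 1`; `δ → 0` (`le_of_forall_mixture_bound`).
[folklore] -/
theorem log_le_functional_of_nonneg
    (g : PseudoRiemannianMetric (𝓡 n) ∞ (EuclideanSpace ℝ (Fin n)) (TangentSpace (𝓡 n) : M → Type _))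
    [g.HasLeviCivita] (f : M → ℝ) (hg : g.IsRiemannian)
    (hA : ∀ (n : ℕ) (M : Type) [TopologicalSpace M] [T2Space M] [SecondCountableTopology M]
      [ChartedSpace (EuclideanSpace ℝ (Fin n)) M] [IsManifold (𝓡 n) ∞ M] [ConnectedSpace M]
      [T3Space M] [MeasurableSpace M] [BorelSpace M]
      (g : PseudoRiemannianMetric (𝓡 n) ∞ (EuclideanSpace ℝ (Fin n)) (TangentSpace (𝓡 n) : M → Type _))
      [g.HasLeviCivita] (f : M → ℝ) (hg : g.IsRiemannian),
      (∀ (x : M) (r : NNReal), IsCompact {y : M | g.edist hg x y ≤ r}) →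
      ContMDiff (𝓡 n) 𝓘(ℝ, ℝ) ∞ f →
      (∀ (x : M) (X Y : TangentSpace (𝓡 n) x),
        g.ricci x X Y + g.hessian f x X Y = (1 / 2 : ℝ) * g.val x X Y) →
      (∀ x : M, g.scalarCurvature x + g.gradSq f x = f x) →
      ∀ x : M, 0 ≤ g.scalarCurvature x)
    (hCN : CarrilloNi2009_shrinkerLSI)
    (hc : ∀ (x : M) (r : NNReal), IsCompact {y : M | g.edist hg x y ≤ r})
    (hf : ContMDiff (𝓡 n) 𝓘(ℝ, ℝ) ∞ f)
    (hsol : ∀ (x : M) (X Y : TangentSpace (𝓡 n) x),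
      g.ricci x X Y + g.hessian f x X Y = (1 / 2 : ℝ) * g.val x X Y)
    (hnorm : ∀ x : M, g.scalarCurvature x + g.gradSq f x = f x)
    {w : M → ℝ} (hw : ContMDiff (𝓡 n) 𝓘(ℝ, ℝ) ∞ w) (hwc : HasCompactSupport w)
    (hZ : 0 < ∫ x, w x ^ 2 ∂g.riemVolume) :
    Real.log ((4 * Real.pi) ^ (-(n : ℝ) / 2) * ∫ x, Real.exp (-f x) ∂g.riemVolume) ≤
      (∫ x, (g.scalarCurvature x * w x ^ 2 + 4 * g.gradSq w x - w x ^ 2 * Real.log (w x ^ 2))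
          ∂g.riemVolume) / (∫ x, w x ^ 2 ∂g.riemVolume) + Real.log (∫ x, w x ^ 2 ∂g.riemVolume) +
        Real.log ((4 * Real.pi) ^ (-(n : ℝ) / 2)) - n := by
  classical
  /- (2.6) at the shrinker at hand, and Haslhofer–Müller's Lemma 2.1 (lower half) given (2.6) -/
  have hS0 : ∀ x, 0 ≤ g.scalarCurvature x := hA n M g f hg hc hf hsol hnorm
  have hk1 : ((1 : ℕ∞) : ℕ∞ω) + 1 ≤ (∞ : ℕ∞ω) := by
    rw [show ((1 : ℕ∞) : ℕ∞ω) + 1 = 2 by norm_num]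
    exact WithTop.coe_le_coe.2 le_top
  haveI : CovariantDerivative.ContMDiffCovariantDerivative g.leviCivita 1 :=
    ⟨g.isLocallyContMDiff_leviCivita_holds 1 hk1 univ isOpen_univ⟩
  haveI : CovariantDerivative.ContMDiffCovariantDerivative g.leviCivita ∞ :=
    ⟨g.isLocallyContMDiff_leviCivita_holds ⊤ (le_of_eq rfl) univ isOpen_univ⟩
  have hgrad : ∀ x, g.gradSq f x ≤ f x := fun x ↦ by linarith [hS0 x, hnorm x]
  obtain ⟨p, hp⟩ := HaslhoferMuller.exists_forall_potential_le g hg hc hf hgrad hsol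
  have hlow : ∀ (x : M) (r : NNReal), (r : ℝ≥0∞) ≤ g.edist hg p x →
      (1 / 4 : ℝ) * (max ((r : ℝ) - 5 * n) 0) ^ 2 ≤ f x := fun x r hr ↦ by
    have h := HaslhoferMuller.potential_lower_of_scalarCurvature_nonneg g hg hc hf hsol hnorm
      hS0 hp x r hr
    rwa [finrank_euclideanSpace_fin] at h
  /- Carrillo–Ni (i)–(iii) -/
  haveI : Nonempty M := ⟨p⟩
  have hc' : ∀ (x : M) (r : NNReal), IsCompact {y : M | g.riemEDist x y ≤ r} := fun x r ↦ by
    simpa [PseudoRiemannianMetric.riemEDist_eq hg] using hc x r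
  obtain ⟨hint, -, hLSI, hsharp⟩ := hCN n M g f hg hc' hf hsol hnorm
  set vol := g.riemVolume with hvol
  set I₀ : ℝ := ∫ x, Real.exp (-f x) ∂vol with hI₀
  set A : ℝ := (4 * Real.pi) ^ (-(n : ℝ) / 2) with hA'
  set c : ℝ := Real.log (A * I₀) with hcdef
  have hApos : 0 < A := Real.rpow_pos_of_pos (by positivity) _
  have hΘpos : 0 < A * I₀ := CarrilloNi2009_shrinkerLSI.theta_pos hg hint
  have hI₀pos : 0 < I₀ := pos_of_mul_pos_right hΘpos hApos.le
  have hcA : Real.log I₀ = c - Real.log A := by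
    rw [hcdef, Real.log_mul hApos.ne' hI₀pos.ne']; ring
  have hf0 : ∀ x, 0 ≤ f x := fun x ↦ by linarith [hnorm x, hS0 x, g.gradSq_nonneg hg f x]
  /- properness of `f`, weighted integrability of `f, R, |∇f|²` -/
  have hprop : ∀ R : ℝ, IsCompact {x | f x ≤ R} :=
    isCompact_sublevel_of_growth hg hf.continuous hc hlow
  obtain ⟨-, hfint⟩ :=
    CarrilloNi2009_shrinkerLSI.integrable_exp_neg_of_proper hg hf hsol hnorm hprop
  obtain ⟨hSint, hgradint⟩ :=
    CarrilloNi2009_shrinkerLSI.integrable_gradSq_mul_exp_neg_of_proper hg hf hsol hnorm hprop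
      (B := 0) (fun x ↦ by rw [neg_zero]; exact hS0 x)
  /- the distance to `p`: `d(p, x)² ≤ 8 f(x) + 50 n²`, measurability -/
  have hD2 : ∀ x, (g.riemEDist p x).toReal ^ 2 ≤ 8 * f x + 2 * (5 * (n : ℝ)) ^ 2 := fun x ↦ by
    have hfin : g.edist hg p x < ⊤ := by
      simpa [PseudoRiemannianMetric.riemEDist_eq hg] using
        CarrilloNi2009_shrinkerLSI.riemEDist_lt_top hg p x
    rw [PseudoRiemannianMetric.riemEDist_eq hg]
    exact toReal_edist_sq_le hg (hlow x) hfin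
  have hDm : Measurable fun x ↦ (g.riemEDist p x).toReal := by
    have hcont : Continuous fun x ↦ g.edist hg p x :=
      (PseudoRiemannianMetric.continuous_edist hg).comp (Continuous.prodMk_right p)
    simp_rw [PseudoRiemannianMetric.riemEDist_eq hg]
    exact hcont.measurable.ennreal_toReal
  /- clause (iii): `∫ (R + |∇f|² + f + c − n) e^{-f} = c ∫ e^{-f}` -/
  have hdens_f : ∀ x, entropyDensity n (fun y ↦ f y + c) 1 x = I₀⁻¹ * Real.exp (-f x) := by
    intro x
    have hd := CarrilloNi2009_shrinkerLSI.entropyDensity_add_log hg hint x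
    rw [← hI₀, ← hA', ← hcdef] at hd
    rw [hd]
    field_simp
  have hWf : ∫ x, (g.scalarCurvature x + g.gradSq f x + (f x + c) - n) * Real.exp (-f x) ∂vol =
      I₀ * c := by
    have hs := hsharp
    rw [PseudoRiemannianMetric.wEntropy_def, finrank_euclideanSpace_fin] at hs
    simp_rw [one_mul, PseudoRiemannianMetric.scalarCurvatureWith_leviCivita, hdens_f,
      show ∀ x, g.gradSq (fun y ↦ f y + c) x = g.gradSq f x from fun x ↦
        CarrilloNi2009_shrinkerLSI.gradSq_add_const c (hf.mdifferentiableAt (by norm_num))] at hs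
    have h1 : ∫ x, (g.scalarCurvature x + g.gradSq f x + (f x + c) - (n : ℕ)) *
        (I₀⁻¹ * Real.exp (-f x)) ∂vol = I₀⁻¹ * ∫ x, (g.scalarCurvature x + g.gradSq f x +
          (f x + c) - n) * Real.exp (-f x) ∂vol := by
      rw [← integral_const_mul]
      refine integral_congr_ae (ae_of_all _ fun x ↦ ?_)
      ring
    rw [h1] at hs
    field_simp at hs
    linarith [hs]
  /- the mixture step for every `0 < δ < 1`, and `δ → 0` -/
  exact le_of_forall_mixture_bound fun δ hδ0 hδ1 ↦
    mixture_step g hg hf hw hwc hS0 hf0 hint hfint hSint hgradint hD2 hDm hZ hI₀pos hcA hLSI hWf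
      hδ0 hδ1

end Shrinker

/-! ## The registered stub (`n = 4`) -/

/-- **Stub `stub_compactSupportLSI_of_nonneg` of line `collapsed-ends-usc`** — Carrillo–Ni's
logarithmic Sobolev inequality on a complete connected normalised 4-d gradient shrinker for
compactly supported smooth `w` (Haslhofer–Müller 2011, (2.15)–(2.16)):
`log((4π)⁻² ∫ e^{-f}) ≤ (∫ (R w² + 4|∇w|² − w² log w²))/∫w² + log ∫w² − log (4π)² − 4`, from
(2.6) (`R ≥ 0` on every complete connected normalised gradient shrinker) and the named fact
`CarrilloNi2009_shrinkerLSI` (`log_le_functional_of_nonneg` at `n = 4`): the landed U1 stub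
`NoncompactShrinkerGapCompactSupportLSI.stub_compactSupportLSI` with the growth fact
`shrinkerPotentialGrowth` weakened to (2.6). The bound `R ≤ C` is not used. [folklore] -/
theorem stub_compactSupportLSI_of_nonneg : (∀ (n : ℕ) (M : Type) [TopologicalSpace M] [T2Space M] [SecondCountableTopology M] [ChartedSpace (EuclideanSpace ℝ (Fin n)) M] [IsManifold (𝓡 n) ∞ M] [ConnectedSpace M] [T3Space M] [MeasurableSpace M] [BorelSpace M] (g : PseudoRiemannianMetric (𝓡 n) ∞ (EuclideanSpace ℝ (Fin n)) (TangentSpace (𝓡 n) : M → Type _)) [g.HasLeviCivita] (f : M → ℝ) (hg : g.IsRiemannian), (∀ (x : M) (r : NNReal), IsCompact {y : M | g.edist hg x y ≤ r}) → ContMDiff (𝓡 n) 𝓘(ℝ, ℝ) ∞ f → (∀ (x : M) (X Y : TangentSpace (𝓡 n) x), g.ricci x X Y + g.hessian f x X Y = (1 / 2 : ℝ) * g.val x X Y) → (∀ x : M, g.scalarCurvature x + g.gradSq f x = f x) → ∀ x : M, 0 ≤ g.scalarCurvature x) → CarrilloNi2009_shrinkerLSI → ∀ (M : Type) [TopologicalSpace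 M] [T2Space M] [SecondCountableTopology M] [ChartedSpace E4 M] [IsManifold (𝓡 4) ∞ M] [ConnectedSpace M] [T3Space M] [MeasurableSpace M] [BorelSpace M] (g : PseudoRiemannianMetric (𝓡 4) ∞ E4 (TangentSpace (𝓡 4) : M → Type _)) [g.HasLeviCivita] (f : M → ℝ) (hg : g.IsRiemannian), (∀ (x : M) (r : NNReal), IsCompact {y : M | g.edist hg x y ≤ r}) → ContMDiff (𝓡 4) 𝓘(ℝ, ℝ) ∞ f → (∀ (x : M) (X Y : TangentSpace (𝓡 4) x), g.ricci x X Y + g.hessian f x X Y = (1 / 2 : ℝ) * g.val x X Y) → (∀ x : M, g.scalarCurvature x + g.gradSq f x = f x) → (∃ C : ℝ, ∀ x : M, g.scalarCurvature x ≤ C) → ∀ w : M → ℝ, ContMDiff (𝓡 4) 𝓘(ℝ, ℝ) ∞ w → HasCompactSupport w → 0 < ∫ x, w x ^ 2 ∂g.riemVolume → Real.log ((4 * Real.pi) ^ (-(4 : ℝ) / 2) * ∫ x, Real.exp (-f x) ∂g.riemVolume) ≤ (∫ x, (g.scalarCurvature x * w x ^ 2 + 4 * g.gradSq w x - w x ^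 2 * Real.log (w x ^ 2)) ∂g.riemVolume) / (∫ x, w x ^ 2 ∂g.riemVolume) + Real.log (∫ x, w x ^ 2 ∂g.riemVolume) - Real.log ((4 * Real.pi) ^ 2) - 4 := by
  intro hA hCN M _ _ _ _ _ _ _ _ _ g _ f hg hc hf hsol hnorm _ w hw hwc hZ
  have h := log_le_functional_of_nonneg (n := 4) g f hg hA hCN hc hf hsol hnorm hw hwc hZ
  have hlogA : Real.log ((4 * Real.pi) ^ (-(4 : ℝ) / 2)) = -Real.log ((4 * Real.pi) ^ 2) := by
    rw [show (-(4 : ℝ) / 2) = -(2 : ℝ) by norm_num, Real.rpow_neg (by positivity), Real.log_inv,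
      Real.rpow_two]
  simp only [Nat.cast_ofNat] at h
  rw [hlogA] at h
  linarith

end Summit.SmoothPoincare4.SmoothPoincare4.Theorems.NoncompactShrinkerGapCompactSupportLSIOfNonneg

end
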